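import Literature.NumberTheory.Automorphic.DiscreteAutomorphicRepArchIsotypy
import Literature.RepresentationTheory.KonnoKonno2007.JunctionCartanDecomposition
import Summits.HodgeConjecture.HodgeConjecture.Theorems.F0P3CMThreeFactor
import Summits.HodgeConjecture.HodgeConjecture.Theorems.F0P3ValueMapTransport
import HarnessLib

/-!
# FLOOR-0 P3 — rung-1 brick S3: letter F1a AT THE CM PIN (the standing hypotheses `hA ∕ hG ∕ hι ∕ hfac` of
# ★ `DiscreteAutomorphicRep.ArchIsotypy` discharged for `U(H)`, `H ∈ M₃(L)` of signature `(2,1)` at `ι`) and the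
# E2′₀-arch ∕ (E)h-arch heads for the archimedean module `P.archModuleCM ι T hT`, BY NAME from F1a

Cell hodgecm-mathlib, FLOOR 0, crux item H413 = stmt-HodgeConjecture-24833, line `Cruxes/H413/Lines/F0_U3CohMultOne.lean`
(rung 1: discharge of the printed-citation letters E2′₀ ∕ (E)h ∕ E1′h along the value-map road, ENGINE-INTERFACES §7h–§7l;
typing memo `F0/P3/typ3/TYPED-D4F1F2.v1`).  PROOF lane (no `def`); author F0P3-p03 (g3).  Imports ★ F1a
`DiscreteAutomorphicRepArchIsotypy`, the Cartan brick ★ `JunctionCartanDecomposition`, the three-factor brick ★ `F0P3CMThreeFactor`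
(F0P3-p04 (g3): `U(H)(𝔸) = U(2,1)_ι · K_c · U(H)(𝔸_f)`, pairwise commuting) and ★ S2 `F0P3ValueMapTransport`.

* §1 `hfac_cmArchSectionUForm` — the TWO-FACTOR commuting-complement hypothesis `hfac` of ★ F1a ∕ ★ F2 VERBATIM at
  `(G, ιG) := (uFormGroup (Fin 2) (Fin 1), cmArchSectionUForm L ι H T hT)`, with `C :=` the centraliser of the range (it
  contains `K_c · U(H)(𝔸_f)` by ★ `F0P3CMThreeFactor`; the `U21`-frame form is ★ `F0P3HolProjectionOfF2.exists_commuting_complement_cmArchSection`).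
* §2 `exists_detecting_irreducible` — **F1a at the CM pin**: from `hF1a : P.ArchIsotypy (uFormGroup (Fin 2) (Fin 1))
  (cmArchSectionUForm L ι H T hT)` ALONE, an irreducible admissible `(𝔤, K)`-module `(M, σK, σ𝔤)` of `U(2,1)_{Fin 2 ⊕ Fin 1}`
  detecting every non-zero vector of `P.archModuleCM ι T hT` — the `hdet` binder of ★ S2 verbatim for
  `(ρK, ρ𝔤) := (P.archRepKCM ι T hT, P.archRepLieCM ι T hT)` (`hA` := ★ `isStarFormallyReal_complex`, `hG` := ★
  `uFormGroup_hasCartanDecomposition`, `hι` := ★ `continuous_cmArchSectionUForm`, `hfac` := §1);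
  `exists_detecting_irreducible_areGKEquivalent` (every irreducible mapping non-trivially into the archimedean module is
  `(𝔤, K)`-equivalent to the detecting one).
* §3 the letter-facing heads: `not_both_types_archModuleCM` (E2′₀-arch(P): `P.archModuleCM` carries no non-zero typed
  null value maps of both types `+I` and `−I`; = ★ S2 `not_both_types_of_detected` ∘ §3, binders = S2's `φp ∕ φm` blocks
  verbatim so that B1′'s `valueMap_hol` ∕ antihol twin plug in with one `exact`), `exists_valueMap_irreducible_archModuleCM`
  ((E)h-arch(P) input: a non-zero typed-`δ` null value map on `P.archModuleCM` yields a non-zero one on an IRREDUCIBLE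
  admissible `M`, to which ★ S0 `exists_smul_eq_of_valueMaps` ∕ `finrank_valueMaps_le_two` apply) and
  `exists_smul_eq_comp_of_valueMaps` ((E)h-arch(P), line form along one detecting map).
References: Flath, Corvallis 1979, Thm. 3–4 [FlathCorvallis1979]; Borel–Jacquet, Corvallis 1979, §4.3, §4.6
[BorelJacquetCorvallis1979]; Rogawski 1990, §15.3 ¶1, Prop. 15.2.1 (b) [Rogawski1990]; Borel–Wallach 2000, VI 4.11
[BorelWallach2000].
HONEST LABEL: HC_CM is proved only modulo the printed citations until rung 0 closes; this file discharges none of them (it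
removes the standing HYPOTHESES of letter F1a at the pin, not the letter).
-/

-- Mathlib idiom (as in `GKModules`, ★ F1a, ★ S0∕S2): commutator bracket on `Module.End`, to MENTION `𝔤 →ₗ⁅ℝ⁆ Module.End ℂ _`
attribute [local instance 100] LieRing.ofAssociativeRing

set_option autoImplicit false
set_option linter.dupNamespace false

noncomputable section

namespace Summit.HodgeConjecture.HodgeConjecture.Cruxes.H413.F0P3ArchIsotypyCM

open NumberField NumberField.InfinitePlace MeasureTheory
open scoped Matrix MatrixGroups
open Literature.Geometry.ComplexHyperbolic.BallModel (U21)
open Literature.RepresentationTheory.BorelWallach2000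
open Literature.NumberTheory.Automorphic Literature.NumberTheory.Automorphic.UnitaryGroup
open Literature.NumberTheory.Automorphic.UnitaryGroup.CotangentForms
open Literature.RepresentationTheory.KonnoKonno2007 Literature.RepresentationTheory.KonnoKonno2007.RealDualPair
open Literature.RepresentationTheory.KonnoKonno2007.RealDualPair.UForm
open Summit.HodgeConjecture.HodgeConjecture.Cruxes.H413.F0P3CMThreeFactor
open Summit.HodgeConjecture.HodgeConjecture.Cruxes.H413.F0P3ValueMapTransport

/-! ## §1 The two-factor `hfac` of letters F1a ∕ F2 at the CM pin, `U(2,1)_{Fin 2 ⊕ Fin 1}` frame -/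

section HFac

variable (L : Type) [Field L] [NumberField L] [IsCMField L] (ι : L →+* ℂ) (H : Matrix (Fin 3) (Fin 3) L)
  (T : GL (Fin 3) ℂ) (hT : (T : Matrix (Fin 3) (Fin 3) ℂ)ᴴ * H.map ι * (T : Matrix (Fin 3) (Fin 3) ℂ) = Literature.Geometry.ComplexHyperbolic.BallModel.J)

/-- **`cmArchSectionUForm L ι H T hT (U(2,1)_{Fin 2 ⊕ Fin 1})` is a COMMUTING FACTOR of `U(H)(𝔸_{L⁺})`** — the `hfac` hypothesis
of ★ F1a `DiscreteAutomorphicRep.ArchIsotypy` ∕ ★ F2 `KFiniteSmoothRepresentative` at `(G, ιG) := (uFormGroup (Fin 2) (Fin 1),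
cmArchSectionUForm)` VERBATIM: with `C` the centraliser of the range, every `g = ιG(u) · (k · (1, b))` by the three-factor
decomposition ★ `F0P3CMThreeFactor.exists_eq_cmArchSectionUForm_mul_mul`, and `k · (1, b) ∈ C` by the pairwise commutations
★ `cmArchSectionUForm_mul_eq_mul_of_mem_cmCompactFactor` ∕ ★ `cmArchSectionUForm_mul_finAdelicToAdelic`.
[cite: BorelJacquetCorvallis1979, §4.1] [cite: PlatonovRapinchuk1994, §5.1] -/
theorem hfac_cmArchSectionUForm :
    ∃ C : Subgroup (adelicGroupData (↥(maximalRealSubfield L)) L (IsCMField.complexConj L) 3 H).Adelic,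
      (∀ (u : (uFormGroup (Fin 2) (Fin 1)).carrier)
          (c : (adelicGroupData (↥(maximalRealSubfield L)) L (IsCMField.complexConj L) 3 H).Adelic), c ∈ C →
          cmArchSectionUForm L ι H T hT u * c = c * cmArchSectionUForm L ι H T hT u) ∧
        ∀ g : (adelicGroupData (↥(maximalRealSubfield L)) L (IsCMField.complexConj L) 3 H).Adelic,
          ∃ (u : (uFormGroup (Fin 2) (Fin 1)).carrier)
            (c : (adelicGroupData (↥(maximalRealSubfield L)) L (IsCMField.complexConj L) 3 H).Adelic),
            c ∈ C ∧ g = cmArchSectionUForm L ι H T hT u * c := by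
  refine ⟨Subgroup.centralizer (Set.range (cmArchSectionUForm L ι H T hT)),
    fun u c hc => Subgroup.mem_centralizer_iff.1 hc _ ⟨u, rfl⟩, fun g => ?_⟩
  obtain ⟨u, k, b, hk, hg⟩ := exists_eq_cmArchSectionUForm_mul_mul L ι H T hT g
  refine ⟨u, k * finAdelicToAdelic (↥(maximalRealSubfield L)) L (IsCMField.complexConj L) 3 H b, ?_,
    hg.trans (mul_assoc _ _ _)⟩
  rw [Subgroup.mem_centralizer_iff]
  rintro _ ⟨v, rfl⟩
  rw [← mul_assoc, cmArchSectionUForm_mul_eq_mul_of_mem_cmCompactFactor L ι H T hT v k hk, mul_assoc,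
    cmArchSectionUForm_mul_finAdelicToAdelic L ι H T hT v b, ← mul_assoc]

end HFac

/-! ## §2 F1a at the CM pin: an irreducible admissible `(𝔤, K)`-module detecting `P.archModuleCM ι T hT` -/

section F1aCM

variable {L : Type} [Field L] [NumberField L] [IsCMField L] (ι : L →+* ℂ) {H : Matrix (Fin 3) (Fin 3) L}
  (T : GL (Fin 3) ℂ) (hT : (T : Matrix (Fin 3) (Fin 3) ℂ)ᴴ * H.map ι * (T : Matrix (Fin 3) (Fin 3) ℂ) = Literature.Geometry.ComplexHyperbolic.BallModel.J)
  {μ : Measure (adelicGroupData (↥(maximalRealSubfield L)) L (IsCMField.complexConj L) 3 H).automorphicQuotient}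
  [(adelicGroupData (↥(maximalRealSubfield L)) L (IsCMField.complexConj L) 3 H).IsAutomorphicMeasure μ]
  (P : DiscreteAutomorphicRep (adelicGroupData (↥(maximalRealSubfield L)) L (IsCMField.complexConj L) 3 H) μ)

/-- **F1a AT THE CM PIN.**  From the letter F1a for `P` along the CM section (`P.ArchIsotypy (uFormGroup (Fin 2) (Fin 1))
(cmArchSectionUForm L ι H T hT)`) ALONE — its standing hypotheses discharged: `ℂ` is star-formally real
(★ `isStarFormallyReal_complex`), `U(2,1) = K · exp 𝔭` (★ `uFormGroup_hasCartanDecomposition`), the section is continuous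
(★ `continuous_cmArchSectionUForm`) and a commuting factor (`hfac_cmArchSectionUForm`) — there is an IRREDUCIBLE ADMISSIBLE
`(𝔤, K)`-module `(M, σK, σ𝔤)` of `U(2,1)_{Fin 2 ⊕ Fin 1}` (the Harish-Chandra module of `P_ι`) whose `(𝔤, K)`-maps detect every
non-zero vector of `P.archModuleCM ι T hT`: the `hdet` binder of ★ S2 `not_both_types_of_detected` for
`(ρK, ρ𝔤) := (P.archRepKCM ι T hT, P.archRepLieCM ι T hT)`. [cite: FlathCorvallis1979, Thm. 3 and Thm. 4]
[cite: BorelJacquetCorvallis1979, §4.3 and §4.6] -/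
theorem exists_detecting_irreducible
    (hF1a : P.ArchIsotypy (uFormGroup (Fin 2) (Fin 1)) (cmArchSectionUForm L ι H T hT)) :
    ∃ (M : Type) (_ : AddCommGroup M) (_ : Module ℂ M)
      (σK : Representation ℂ (uFormGroup (Fin 2) (Fin 1)).maximalCompact M)
      (σ𝔤 : (uFormGroup (Fin 2) (Fin 1)).lie →ₗ⁅ℝ⁆ Module.End ℂ M),
      IsGKModule (uFormGroup (Fin 2) (Fin 1)) σK σ𝔤 ∧ IsIrreducibleGK σK σ𝔤 ∧ IsAdmissibleGK σK ∧
        ∀ v : P.archModuleCM ι T hT, v ≠ 0 →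
          ∃ φ : P.archModuleCM ι T hT →ₗ[ℂ] M,
            (∀ (k : (uFormGroup (Fin 2) (Fin 1)).maximalCompact) (w : P.archModuleCM ι T hT),
                φ (P.archRepKCM ι T hT k w) = σK k (φ w)) ∧
              (∀ (X : (uFormGroup (Fin 2) (Fin 1)).lie) (w : P.archModuleCM ι T hT),
                φ (P.archRepLieCM ι T hT X w) = σ𝔤 X (φ w)) ∧
              φ v ≠ 0 :=
  hF1a.exists_ne_zero_map isStarFormallyReal_complex (uFormGroup_hasCartanDecomposition (Fin 2) (Fin 1))
    (continuous_cmArchSectionUForm L ι H T hT) (hfac_cmArchSectionUForm L ι H T hT)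

/-- **Every irreducible `(𝔤, K)`-module mapping non-trivially into `P.archModuleCM ι T hT` is equivalent to the detecting
module** (★ `ArchIsotypy.areGKEquivalent_of_isIrreducibleGK` at the pin). [cite: FlathCorvallis1979, Thm. 3 and Thm. 4] -/
theorem exists_detecting_irreducible_areGKEquivalent
    (hF1a : P.ArchIsotypy (uFormGroup (Fin 2) (Fin 1)) (cmArchSectionUForm L ι H T hT)) :
    ∃ (M : Type) (_ : AddCommGroup M) (_ : Module ℂ M)
      (σK : Representation ℂ (uFormGroup (Fin 2) (Fin 1)).maximalCompact M)
      (σ𝔤 : (uFormGroup (Fin 2) (Fin 1)).lie →ₗ⁅ℝ⁆ Module.End ℂ M),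
      IsGKModule (uFormGroup (Fin 2) (Fin 1)) σK σ𝔤 ∧ IsIrreducibleGK σK σ𝔤 ∧ IsAdmissibleGK σK ∧
        ∀ (W : Type) [AddCommGroup W] [Module ℂ W] (τK : Representation ℂ (uFormGroup (Fin 2) (Fin 1)).maximalCompact W)
          (τ𝔤 : (uFormGroup (Fin 2) (Fin 1)).lie →ₗ⁅ℝ⁆ Module.End ℂ W) (j : W →ₗ[ℂ] P.archModuleCM ι T hT),
          IsIrreducibleGK τK τ𝔤 →
          (∀ (k : (uFormGroup (Fin 2) (Fin 1)).maximalCompact) (w : W), j (τK k w) = P.archRepKCM ι T hT k (j w)) →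
          (∀ (X : (uFormGroup (Fin 2) (Fin 1)).lie) (w : W), j (τ𝔤 X w) = P.archRepLieCM ι T hT X (j w)) →
          j ≠ 0 → AreGKEquivalent τK τ𝔤 σK σ𝔤 :=
  hF1a.areGKEquivalent_of_isIrreducibleGK isStarFormallyReal_complex (uFormGroup_hasCartanDecomposition (Fin 2) (Fin 1))
    (continuous_cmArchSectionUForm L ι H T hT) (hfac_cmArchSectionUForm L ι H T hT)

/-! ## §3 E2′₀-arch(P) and (E)h-arch(P) for the archimedean module of `P`, by name from F1a -/

/-- **E2′₀ at the archimedean place for `P.archModuleCM ι T hT`, from letter F1a.**  The archimedean `(𝔤, K)`-module of a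
discrete automorphic `P` of `U(H)` at `ι` carries NO pair of non-zero typed null value maps `φp` (type `+I`: `K`-equivariant,
horizontal, `z₀`-weight `+i`, `𝔭⁻`-null values — the shape of the value map of a holomorphic cotangent form) and `φm` (type
`−I`, an antiholomorphic one): its non-zero vectors are detected by `(𝔤, K)`-maps into ONE irreducible admissible module
(`exists_detecting_irreducible`), on which ★ S0 `not_both_types_of_valueMaps` (T6a, Borel–Wallach VI 4.11 ∕ Rogawski 15.2.1 (b))
forbids both types — ★ S2 `not_both_types_of_detected`.  Binders = S2's `φp`∕`φm` blocks verbatim.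
[cite: Rogawski1990, §15.3 ¶1; Prop. 15.2.1 (b)] [cite: BorelWallach2000, VI Thm. 4.11] [cite: FlathCorvallis1979, Thm. 3] -/
theorem not_both_types_archModuleCM
    (hF1a : P.ArchIsotypy (uFormGroup (Fin 2) (Fin 1)) (cmArchSectionUForm L ι H T hT))
    (φp φm : (uFormGroup (Fin 2) (Fin 1)).lie →ₗ[ℝ] P.archModuleCM ι T hT)
    (hp0 : ∀ W ∈ (uFormGroup (Fin 2) (Fin 1)).kInLie, φp W = 0)
    (hpK : ∀ (k : (uFormGroup (Fin 2) (Fin 1)).maximalCompact) (X : (uFormGroup (Fin 2) (Fin 1)).lie),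
      P.archRepKCM ι T hT k (φp X) =
        φp ((uFormGroup (Fin 2) (Fin 1)).Ad (Subgroup.inclusion (uFormGroup (Fin 2) (Fin 1)).maximalCompact_le_carrier k) X))
    (hp𝔨 : ∀ W ∈ (uFormGroup (Fin 2) (Fin 1)).kInLie, ∀ X : (uFormGroup (Fin 2) (Fin 1)).lie,
      φp ⁅W, X⁆ = P.archRepLieCM ι T hT W (φp X))
    (hpwt : ∀ X : (uFormGroup (Fin 2) (Fin 1)).lie,
      P.archRepLieCM ι T hT (upqZ0 (Fin 2) (Fin 1)) (φp X) = Complex.I • φp X)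
    (hpN : ∀ (X : (uFormGroup (Fin 2) (Fin 1)).lie) (s : (Fin 2 × Fin 1) × Fin 2),
      P.archRepLieCM ι T hT (upqPBasis s) (φp X) +
        Complex.I • P.archRepLieCM ι T hT ⁅upqZ0 (Fin 2) (Fin 1), upqPBasis s⁆ (φp X) = 0)
    (hm0 : ∀ W ∈ (uFormGroup (Fin 2) (Fin 1)).kInLie, φm W = 0)
    (hmK : ∀ (k : (uFormGroup (Fin 2) (Fin 1)).maximalCompact) (X : (uFormGroup (Fin 2) (Fin 1)).lie),
      P.archRepKCM ι T hT k (φm X) =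
        φm ((uFormGroup (Fin 2) (Fin 1)).Ad (Subgroup.inclusion (uFormGroup (Fin 2) (Fin 1)).maximalCompact_le_carrier k) X))
    (hm𝔨 : ∀ W ∈ (uFormGroup (Fin 2) (Fin 1)).kInLie, ∀ X : (uFormGroup (Fin 2) (Fin 1)).lie,
      φm ⁅W, X⁆ = P.archRepLieCM ι T hT W (φm X))
    (hmwt : ∀ X : (uFormGroup (Fin 2) (Fin 1)).lie,
      P.archRepLieCM ι T hT (upqZ0 (Fin 2) (Fin 1)) (φm X) = (-Complex.I) • φm X)
    (hmN : ∀ (X : (uFormGroup (Fin 2) (Fin 1)).lie) (s : (Fin 2 × Fin 1) × Fin 2),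
      P.archRepLieCM ι T hT (upqPBasis s) (φm X) +
        (-Complex.I) • P.archRepLieCM ι T hT ⁅upqZ0 (Fin 2) (Fin 1), upqPBasis s⁆ (φm X) = 0)
    (hp : φp ≠ 0) (hm : φm ≠ 0) : False := by
  obtain ⟨M, _, _, σK, σ𝔤, hGK, hirr, -, hdet⟩ := exists_detecting_irreducible ι T hT P hF1a
  exact not_both_types_of_detected (P.archRepKCM ι T hT) (P.archRepLieCM ι T hT) σK σ𝔤 hGK.ad_compat hirr hdet φp φm
    hp0 hpK hp𝔨 hpwt hpN hm0 hmK hm𝔨 hmwt hmN hp hm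

/-- **(E)h at the archimedean place for `P.archModuleCM ι T hT`, from letter F1a (input form).**  A non-zero typed-`δ` null
value map on the archimedean module of `P` yields a non-zero typed-`δ` null value map on an IRREDUCIBLE ADMISSIBLE `(𝔤, K)`-module
`(M, σK, σ𝔤)` of `U(2,1)_{Fin 2 ⊕ Fin 1}` (★ S2 `exists_valueMap_irreducible_of_detected` ∘ `exists_detecting_irreducible`), where
the typed-`δ` null value maps form a complex line (★ S0 `exists_smul_eq_of_valueMaps` ∕ `finrank_valueMaps_le_two`, `δ = ±1`).
[cite: BorelWallach2000, VI Thm. 4.11 (3)] [cite: Rogawski1990, Prop. 15.2.1 (b)] [cite: FlathCorvallis1979, Thm. 3] -/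
theorem exists_valueMap_irreducible_archModuleCM
    (hF1a : P.ArchIsotypy (uFormGroup (Fin 2) (Fin 1)) (cmArchSectionUForm L ι H T hT)) {δ : ℤ}
    (φ : (uFormGroup (Fin 2) (Fin 1)).lie →ₗ[ℝ] P.archModuleCM ι T hT) (hφ : φ ≠ 0)
    (h0 : ∀ W ∈ (uFormGroup (Fin 2) (Fin 1)).kInLie, φ W = 0)
    (hK : ∀ (k : (uFormGroup (Fin 2) (Fin 1)).maximalCompact) (X : (uFormGroup (Fin 2) (Fin 1)).lie),
      P.archRepKCM ι T hT k (φ X) =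
        φ ((uFormGroup (Fin 2) (Fin 1)).Ad (Subgroup.inclusion (uFormGroup (Fin 2) (Fin 1)).maximalCompact_le_carrier k) X))
    (h𝔨 : ∀ W ∈ (uFormGroup (Fin 2) (Fin 1)).kInLie, ∀ X : (uFormGroup (Fin 2) (Fin 1)).lie,
      φ ⁅W, X⁆ = P.archRepLieCM ι T hT W (φ X))
    (hwt : ∀ X : (uFormGroup (Fin 2) (Fin 1)).lie,
      P.archRepLieCM ι T hT (upqZ0 (Fin 2) (Fin 1)) (φ X) = ((δ : ℂ) * Complex.I) • φ X)
    (hN : ∀ (X : (uFormGroup (Fin 2) (Fin 1)).lie) (s : (Fin 2 × Fin 1) × Fin 2),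
      P.archRepLieCM ι T hT (upqPBasis s) (φ X) +
        ((δ : ℂ) * Complex.I) • P.archRepLieCM ι T hT ⁅upqZ0 (Fin 2) (Fin 1), upqPBasis s⁆ (φ X) = 0) :
    ∃ (M : Type) (_ : AddCommGroup M) (_ : Module ℂ M)
      (σK : Representation ℂ (uFormGroup (Fin 2) (Fin 1)).maximalCompact M)
      (σ𝔤 : (uFormGroup (Fin 2) (Fin 1)).lie →ₗ⁅ℝ⁆ Module.End ℂ M),
      IsGKModule (uFormGroup (Fin 2) (Fin 1)) σK σ𝔤 ∧ IsIrreducibleGK σK σ𝔤 ∧ IsAdmissibleGK σK ∧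
        ∃ ψ : (uFormGroup (Fin 2) (Fin 1)).lie →ₗ[ℝ] M, ψ ≠ 0 ∧
          (∀ W ∈ (uFormGroup (Fin 2) (Fin 1)).kInLie, ψ W = 0) ∧
          (∀ (k : (uFormGroup (Fin 2) (Fin 1)).maximalCompact) (X : (uFormGroup (Fin 2) (Fin 1)).lie),
            σK k (ψ X) =
              ψ ((uFormGroup (Fin 2) (Fin 1)).Ad (Subgroup.inclusion (uFormGroup (Fin 2) (Fin 1)).maximalCompact_le_carrier k) X)) ∧
          (∀ W ∈ (uFormGroup (Fin 2) (Fin 1)).kInLie, ∀ X : (uFormGroup (Fin 2) (Fin 1)).lie, ψ ⁅W, X⁆ = σ𝔤 W (ψ X)) ∧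
          (∀ X : (uFormGroup (Fin 2) (Fin 1)).lie, σ𝔤 (upqZ0 (Fin 2) (Fin 1)) (ψ X) = ((δ : ℂ) * Complex.I) • ψ X) ∧
          (∀ (X : (uFormGroup (Fin 2) (Fin 1)).lie) (s : (Fin 2 × Fin 1) × Fin 2),
            σ𝔤 (upqPBasis s) (ψ X) + ((δ : ℂ) * Complex.I) • σ𝔤 ⁅upqZ0 (Fin 2) (Fin 1), upqPBasis s⁆ (ψ X) = 0) := by
  obtain ⟨M, _, _, σK, σ𝔤, hGK, hirr, hadm, hdet⟩ := exists_detecting_irreducible ι T hT P hF1a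
  obtain ⟨ψ, hψ, hrest⟩ := exists_valueMap_irreducible_of_detected (P.archRepKCM ι T hT) (P.archRepLieCM ι T hT) σK σ𝔤
    hdet φ hφ h0 hK h𝔨 hwt hN
  exact ⟨M, inferInstance, inferInstance, σK, σ𝔤, hGK, hirr, hadm, ψ, hψ, hrest⟩

/-- **(E)h at the archimedean place, LINE FORM, from letter F1a**: along any ONE `(𝔤, K)`-map `Tm : P.archModuleCM ι T hT → M`
into the detecting irreducible module, two typed-`δ` null value maps `φ`, `φ′` on `P.archModuleCM` (`δ = ±1`) with
`Tm ∘ φ ≠ 0` have COMPLEX-PROPORTIONAL images: `Tm ∘ φ′ = c • (Tm ∘ φ)` (★ S2 `valueMap_comp` + ★ S0 `exists_smul_eq_of_valueMaps`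
on `M`).  This is the archimedean half of the cotangent isotypic LINE; the finite half is Schur for `σ`.
[cite: BorelWallach2000, VI Thm. 4.11 (3)] [cite: Rogawski1990, Prop. 15.2.1 (b)] -/
theorem exists_smul_eq_comp_of_valueMaps
    {M : Type} [AddCommGroup M] [Module ℂ M]
    (σK : Representation ℂ (uFormGroup (Fin 2) (Fin 1)).maximalCompact M)
    (σ𝔤 : (uFormGroup (Fin 2) (Fin 1)).lie →ₗ⁅ℝ⁆ Module.End ℂ M)
    (hGK : IsGKModule (uFormGroup (Fin 2) (Fin 1)) σK σ𝔤) (hirr : IsIrreducibleGK σK σ𝔤)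
    (Tm : P.archModuleCM ι T hT →ₗ[ℂ] M)
    (hTK : ∀ (k : (uFormGroup (Fin 2) (Fin 1)).maximalCompact) (w : P.archModuleCM ι T hT),
      Tm (P.archRepKCM ι T hT k w) = σK k (Tm w))
    (hT𝔤 : ∀ (X : (uFormGroup (Fin 2) (Fin 1)).lie) (w : P.archModuleCM ι T hT),
      Tm (P.archRepLieCM ι T hT X w) = σ𝔤 X (Tm w))
    {δ : ℤ} (hδ : δ = 1 ∨ δ = -1)
    (φ φ' : (uFormGroup (Fin 2) (Fin 1)).lie →ₗ[ℝ] P.archModuleCM ι T hT)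
    (h0 : ∀ W ∈ (uFormGroup (Fin 2) (Fin 1)).kInLie, φ W = 0)
    (hK : ∀ (k : (uFormGroup (Fin 2) (Fin 1)).maximalCompact) (X : (uFormGroup (Fin 2) (Fin 1)).lie),
      P.archRepKCM ι T hT k (φ X) =
        φ ((uFormGroup (Fin 2) (Fin 1)).Ad (Subgroup.inclusion (uFormGroup (Fin 2) (Fin 1)).maximalCompact_le_carrier k) X))
    (h𝔨 : ∀ W ∈ (uFormGroup (Fin 2) (Fin 1)).kInLie, ∀ X : (uFormGroup (Fin 2) (Fin 1)).lie,
      φ ⁅W, X⁆ = P.archRepLieCM ι T hT W (φ X))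
    (hwt : ∀ X : (uFormGroup (Fin 2) (Fin 1)).lie,
      P.archRepLieCM ι T hT (upqZ0 (Fin 2) (Fin 1)) (φ X) = ((δ : ℂ) * Complex.I) • φ X)
    (hN : ∀ (X : (uFormGroup (Fin 2) (Fin 1)).lie) (s : (Fin 2 × Fin 1) × Fin 2),
      P.archRepLieCM ι T hT (upqPBasis s) (φ X) +
        ((δ : ℂ) * Complex.I) • P.archRepLieCM ι T hT ⁅upqZ0 (Fin 2) (Fin 1), upqPBasis s⁆ (φ X) = 0)
    (h0' : ∀ W ∈ (uFormGroup (Fin 2) (Fin 1)).kInLie, φ' W = 0)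
    (hK' : ∀ (k : (uFormGroup (Fin 2) (Fin 1)).maximalCompact) (X : (uFormGroup (Fin 2) (Fin 1)).lie),
      P.archRepKCM ι T hT k (φ' X) =
        φ' ((uFormGroup (Fin 2) (Fin 1)).Ad (Subgroup.inclusion (uFormGroup (Fin 2) (Fin 1)).maximalCompact_le_carrier k) X))
    (h𝔨' : ∀ W ∈ (uFormGroup (Fin 2) (Fin 1)).kInLie, ∀ X : (uFormGroup (Fin 2) (Fin 1)).lie,
      φ' ⁅W, X⁆ = P.archRepLieCM ι T hT W (φ' X))
    (hwt' : ∀ X : (uFormGroup (Fin 2) (Fin 1)).lie,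
      P.archRepLieCM ι T hT (upqZ0 (Fin 2) (Fin 1)) (φ' X) = ((δ : ℂ) * Complex.I) • φ' X)
    (hN' : ∀ (X : (uFormGroup (Fin 2) (Fin 1)).lie) (s : (Fin 2 × Fin 1) × Fin 2),
      P.archRepLieCM ι T hT (upqPBasis s) (φ' X) +
        ((δ : ℂ) * Complex.I) • P.archRepLieCM ι T hT ⁅upqZ0 (Fin 2) (Fin 1), upqPBasis s⁆ (φ' X) = 0)
    (hφ : Tm.restrictScalars ℝ ∘ₗ φ ≠ 0) :
    ∃ c : ℂ, Tm.restrictScalars ℝ ∘ₗ φ' = c • (Tm.restrictScalars ℝ ∘ₗ φ) := by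
  obtain ⟨q0, qK, q𝔨, qwt, qN⟩ := valueMap_comp φ Tm hTK hT𝔤 h0 hK h𝔨 hwt hN
  obtain ⟨r0, rK, r𝔨, rwt, rN⟩ := valueMap_comp φ' Tm hTK hT𝔤 h0' hK' h𝔨' hwt' hN'
  exact F0P3ArchValueMapRigidity.exists_smul_eq_of_valueMaps σK σ𝔤 hGK.ad_compat hirr hδ _ _ q0 qK q𝔨 qwt qN
    r0 rK r𝔨 rwt rN hφ

end F1aCM

end Summit.HodgeConjecture.HodgeConjecture.Cruxes.H413.F0P3ArchIsotypyCM

end
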